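import Summits.AtomisticToContinuum.Crystallization.Theses.HullExactificationCascade
import Summits.AtomisticToContinuum.Crystallization.Theorems.HullExactificationCascadeHullBulkOptimalMatch
import Summits.AtomisticToContinuum.Crystallization.Theorems.ChargedEnergyGap.Negative.Tolerance
import Literature.MathematicalPhysics.StatisticalMechanics.LocalLimitOfGroundStates

/-!
# Route `HullExactificationCascade`, item `HullBulkOptimal` (stmt-AtomisticToContinuum-12090), III:
# hull elements are bulk optimal up to a volume error

MAIN RESULT (`hullBulkOptimal_proof`, closing the route decl
`HullExactificationCascade.HullBulkOptimal`): for Lennard-Jones ground states `x^N` in `ℝ³` and a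
set `S` which is a local limit of translates `x^(φ j) + τ_j` (two-way `ε`-matching on every ball,
eventually in `j`), for every `ε > 0` there is `L₀` such that for all `L ≥ L₀` and all centres
`c`, `Σ_{y ∈ S ∩ B̄_L(c)} Σ'_{z ∈ S, z ≠ y} V_LJ(|y − z|) ≤ 2 e_∞ #(S ∩ B̄_L(c)) + ε L³`,
`e_∞ = liminf E(N)/N` (`= lim`, `BlancLewin2015_8_holds`).

MECHANISM (`HullBulkOptimal.sum_site_le_of_matched`).  Let `r` be the uniform separation of
Lennard-Jones ground states (`LennardJonesMinimalDistance_holds`); `S` is `r`-separated too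
(`le_dist_of_eventually_matched`).  Fix `ε`; choose a truncation radius `ρ` (far tails
`≤ (ε/4) L³` in total), a modulus `ω` of `V_LJ` on `[r, ρ + 1]` (Heine–Cantor) with total
continuity error `(ε/8) L³`, and `L₀` absorbing the surface term `C (L + 1)² ≤ (ε/4) L³` of
part I and the threshold beyond which `E(n) ≤ (e_∞ + ε') n`.  Given `L ≥ L₀` and `c`, the
finitely many points `Y = S ∩ B̄_L(c)` and their `ρ`-neighbours are, for ONE good index `j`,
matched injectively to particles of `p = x^(φ j) + τ_j`, the particles of `p` in `B̄_{L+ε₁}(c)`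
being exactly the images of `Y` once `ε₁` is below the gap between `L` and the next distance
`dist(s, c)`, `s ∈ S` (part II).  Each site sum of `S` at a point of `Y` is at most the site
energy of its match plus `(2ρ/r+1)³ ω + tail` (part II, `tsum_site_le_siteEnergy_add`), and the
site energies of the particles of `p` in the ball sum to `≤ 2 E(n) + C (L + ε₁)²` by the
cut-and-paste bound of part I (`exists_sum_siteEnergy_ball_le`).  All `[folklore]`
(Blanc–Lewin 2015, §1.2–§1.3, §2.2).
-/

noncomputable section

namespace Summit.AtomisticToContinuum.Crystallization.Theorems

open scoped BigOperators Topology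
open Filter Set Metric
open Literature.MathematicalPhysics.StatisticalMechanics
open Summit.AtomisticToContinuum.Crystallization.Theorems.CoarseGrains.Negative.PredicateAPI (E3)
open Summit.AtomisticToContinuum.Crystallization.Theorems.HullBulkOptimal

/-- **Local limits of translated Lennard-Jones ground states are bulk optimal up to a volume
error.** If `X ⊆ ℝ³` is two-way `ε`-matched on every ball, eventually in `j`, by the translates
`x^(φ j) + τ_j` of Lennard-Jones ground states, then for every `ε > 0` there is `L₀` with
`Σ_{y ∈ X ∩ B̄_L(c)} Σ'_{z ∈ X, z ≠ y} V_LJ(|y − z|) ≤ 2 (liminf E(N)/N) #(X ∩ B̄_L(c)) + ε L³`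
for all `L ≥ L₀` and all `c` (cut-and-paste in one well-matched ground state, see the module
docstring). [folklore] -/
theorem HullBulkOptimal.sum_site_le_of_matched
    (x : (N : ℕ) → (Fin N → E3)) (hx : ∀ N, IsGroundState lennardJones (x N))
    {X : Set E3} {φ : ℕ → ℕ} {τ : ℕ → E3}
    (hlim : ∀ R ε : ℝ, 0 < ε → ∀ᶠ j : ℕ in atTop,
      (∀ s ∈ X, ‖s‖ ≤ R → ∃ i : Fin (φ j), dist (x (φ j) i + τ j) s ≤ ε) ∧
      (∀ i : Fin (φ j), ‖x (φ j) i + τ j‖ ≤ R → ∃ s ∈ X, dist (x (φ j) i + τ j) s ≤ ε))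
    {ε : ℝ} (hε : 0 < ε) :
    ∃ L₀ : ℝ, ∀ L : ℝ, L₀ ≤ L → ∀ c : E3,
      (∑' y : ↥({y : E3 | y ∈ X ∧ dist y c ≤ L} : Set E3),
        ∑' z : ↥({z : E3 | z ∈ X ∧ z ≠ (y : E3)} : Set E3),
          lennardJones (dist (y : E3) (z : E3))) ≤
      2 * liminf (fun N : ℕ => groundStateEnergy lennardJones 3 N / (N : ℝ)) atTop *
          (({y : E3 | y ∈ X ∧ dist y c ≤ L} : Set E3).ncard : ℝ) + ε * L ^ 3 := by
  classical
  /- (0) the constants -/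
  obtain ⟨r, hr, hsepgs⟩ := LennardJonesMinimalDistance_holds
  have hsepX : ∀ a ∈ X, ∀ b ∈ X, a ≠ b → r ≤ dist a b := fun a ha b hb hab =>
    le_dist_of_eventually_matched (X := X) (y := fun j i => x (φ j) i + τ j)
      (fun j i i' hii' => by
        show r ≤ dist (x (φ j) i + τ j) (x (φ j) i' + τ j)
        rw [dist_add_right]
        exact hsepgs _ _ (hx _) i i' hii') hlim ha hb hab
  obtain ⟨e, he_neg, he_tend, -⟩ := BlancLewin2015_8_holds 3 (by norm_num) (by norm_num)
  rw [he_tend.liminf_eq]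
  -- packing constant `K₀`: `#(X ∩ B̄_L(c)) ≤ K₀ L³` for `L ≥ 1`
  set K₀ : ℝ := (2 / r + 1) ^ 3 with hK₀
  have hK₀pos : 0 < K₀ := by positivity
  -- the cut constant of part I
  obtain ⟨C, hC0, hcut⟩ := exists_sum_siteEnergy_ball_le hr
  -- the energy threshold
  have hε' : 0 < ε / (8 * K₀) := by positivity
  obtain ⟨n₀, hn₀⟩ := eventually_atTop.1
    (he_tend.eventually (eventually_lt_nhds (lt_add_of_pos_right e hε')))
  -- the truncation radius `ρ` and the tail constant `T`
  set Q : ℝ := 8192 * K₀ / (6 * r ^ 3) with hQ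
  have hQpos : 0 < Q := by positivity
  set ρ : ℝ := 2 + 2 * r + Q * (4 / ε) with hρ
  have hQε : 0 ≤ Q * (4 / ε) := by positivity
  have hρ2 : 2 ≤ ρ := by linarith
  have hρ1 : 1 ≤ ρ := by linarith
  have hρpos : 0 < ρ := by linarith
  have hρr : r ≤ ρ / 2 := by linarith
  set T : ℝ := 1 / 6 * (1024 / (r ^ 3 * (ρ / 2) ^ 3)) with hT
  have hT0 : 0 ≤ T := by positivity
  have hKT : K₀ * T ≤ ε / 4 := by
    have h1 : K₀ * T = Q / ρ ^ 3 := by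
      rw [hT, hQ]
      field_simp
      ring
    have hρ3 : ρ ≤ ρ ^ 3 := by
      have h := mul_le_mul (le_refl ρ) (one_le_pow₀ (n := 2) hρ1) zero_le_one hρpos.le
      calc ρ = ρ * 1 := (mul_one ρ).symm
        _ ≤ ρ * ρ ^ 2 := h
        _ = ρ ^ 3 := by ring
    have h2 : Q / ρ ^ 3 ≤ Q / (Q * (4 / ε)) :=
      div_le_div_of_nonneg_left hQpos.le (by positivity) (by linarith)
    have h3 : Q / (Q * (4 / ε)) = ε / 4 := by
      field_simp
    linarith
  -- the near count `M` and the modulus `ω`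
  set M : ℝ := (2 * ρ / r + 1) ^ 3 with hM
  have hMpos : 0 < M := by positivity
  set ω : ℝ := ε / (8 * K₀ * M) with hω
  have hωpos : 0 < ω := by positivity
  have hKMω : K₀ * M * ω = ε / 8 := by
    rw [hω]
    field_simp
  -- uniform continuity of `V_LJ` on `[r, ρ + 1]`
  have hcont : ContinuousOn lennardJones (Set.Icc r (ρ + 1)) :=
    continuousOn_lennardJones.mono fun s hs h0 => by
      have h00 : (s : ℝ) = 0 := h0
      linarith [hs.1]
  obtain ⟨ε₀, hε₀, hmod⟩ := Metric.uniformContinuousOn_iff_le.1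
    (isCompact_Icc.uniformContinuousOn_of_continuous hcont) ω hωpos
  -- the threshold radius
  have hne0 : 0 ≤ -e := by linarith
  refine ⟨1 + 16 * C / ε + 8 * (-e) * n₀ / ε, fun L hL c => ?_⟩
  have hLC0 : 0 ≤ 16 * C / ε := by positivity
  have hLe0 : 0 ≤ 8 * (-e) * n₀ / ε := by positivity
  have hL1 : 1 ≤ L := by linarith
  have hL0 : 0 < L := by linarith
  have hLC : 16 * C / ε ≤ L := by linarith
  have hLe : 8 * (-e) * n₀ / ε ≤ L := by linarith
  have hLL3 : L ≤ L ^ 3 := by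
    have h := mul_le_mul (le_refl L) (one_le_pow₀ (n := 2) hL1) zero_le_one hL0.le
    calc L = L * 1 := (mul_one L).symm
      _ ≤ L * L ^ 2 := h
      _ = L ^ 3 := by ring
  /- (1) the finite sets of points -/
  set Y : Set E3 := {y : E3 | y ∈ X ∧ dist y c ≤ L} with hY
  have hYfin : Y.Finite :=
    finite_of_forall_le_dist_of_subset_closedBall hr
      (fun a ha b hb hab => hsepX a ha.1 b hb.1 hab) (c := c) (R := L)
      (fun a ha => mem_closedBall.2 ha.2)
  have hWfin : ({w : E3 | w ∈ X ∧ dist w c ≤ L + ρ + 1} : Set E3).Finite :=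
    finite_of_forall_le_dist_of_subset_closedBall hr
      (fun a ha b hb hab => hsepX a ha.1 b hb.1 hab) (c := c) (R := L + ρ + 1)
      (fun a ha => mem_closedBall.2 ha.2)
  set Yf : Finset E3 := hYfin.toFinset with hYf
  set Wf : Finset E3 := hWfin.toFinset with hWf
  have hmemY : ∀ y : E3, y ∈ Yf ↔ y ∈ X ∧ dist y c ≤ L := fun y => by
    rw [hYf, Set.Finite.mem_toFinset]
    rfl
  have hmemW : ∀ w : E3, w ∈ Wf ↔ w ∈ X ∧ dist w c ≤ L + ρ + 1 := fun w => by
    rw [hWf, Set.Finite.mem_toFinset]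
    rfl
  have hYW : Yf ⊆ Wf := fun y hy =>
    (hmemW y).2 ⟨((hmemY y).1 hy).1, by linarith [((hmemY y).1 hy).2]⟩
  have hncard : Y.ncard = Yf.card := Set.ncard_eq_toFinset_card Y hYfin
  have hnK : (Yf.card : ℝ) ≤ K₀ * L ^ 3 := by
    have h := ncard_ball_le hr hsepX c hL0.le
    rw [hncard] at h
    have h2 : 2 * L / r + 1 ≤ (2 / r + 1) * L := by
      rw [add_mul, div_mul_eq_mul_div, mul_comm 2 L]
      linarith
    calc (Yf.card : ℝ) ≤ (2 * L / r + 1) ^ 3 := h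
      _ ≤ ((2 / r + 1) * L) ^ 3 := pow_le_pow_left₀ (by positivity) h2 3
      _ = K₀ * L ^ 3 := by rw [hK₀]; ring
  -- the outer `tsum` is a finite sum
  have hLHS : (∑' y : ↥Y, ∑' z : ↥({z : E3 | z ∈ X ∧ z ≠ (y : E3)} : Set E3),
      lennardJones (dist (y : E3) (z : E3))) =
      ∑ y ∈ Yf, ∑' z : ↥({z : E3 | z ∈ X ∧ z ≠ y} : Set E3), lennardJones (dist y (z : E3)) :=
    tsum_finite_eq_sum hYfin
      (fun y => ∑' z : ↥({z : E3 | z ∈ X ∧ z ≠ y} : Set E3), lennardJones (dist y (z : E3)))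
  rw [hLHS, hncard]
  /- (2) the empty ball -/
  rcases Yf.eq_empty_or_nonempty with hY0 | ⟨y₀, hy₀⟩
  · rw [hY0, Finset.sum_empty, Finset.card_empty]
    simp only [Nat.cast_zero, mul_zero, zero_add]
    positivity
  obtain ⟨hy₀X, hy₀L⟩ := (hmemY y₀).1 hy₀
  /- (3) the gap and the tolerance -/
  obtain ⟨g, hg, hgap⟩ := exists_gap Wf c (L := L) (b := ρ + 1) (by linarith)
    (fun w hwX hwc => (hmemW w).2 ⟨hwX, by linarith⟩)
  obtain ⟨ε₁, hε₁, hε₁ε₀, hε₁r, hε₁4, hε₁g⟩ : ∃ ε₁ : ℝ, 0 < ε₁ ∧ 2 * ε₁ ≤ ε₀ ∧ 4 * ε₁ < r ∧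
      4 * ε₁ ≤ 1 ∧ 2 * ε₁ ≤ g := by
    refine ⟨min (min (ε₀ / 2) (r / 8)) (min (1 / 4) (g / 2)), ?_, ?_, ?_, ?_, ?_⟩
    · exact lt_min (lt_min (by linarith) (by linarith)) (lt_min (by norm_num) (by linarith))
    · linarith [min_le_left (min (ε₀ / 2) (r / 8)) (min (1 / 4) (g / 2)),
        min_le_left (ε₀ / 2) (r / 8)]
    · linarith [min_le_left (min (ε₀ / 2) (r / 8)) (min (1 / 4) (g / 2)),
        min_le_right (ε₀ / 2) (r / 8)]
    · linarith [min_le_right (min (ε₀ / 2) (r / 8)) (min (1 / 4) (g / 2)),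
        min_le_left (1 / 4 : ℝ) (g / 2)]
    · linarith [min_le_right (min (ε₀ / 2) (r / 8)) (min (1 / 4) (g / 2)),
        min_le_right (1 / 4 : ℝ) (g / 2)]
  /- (4) one well-matched ground state -/
  obtain ⟨j, hAj, hBj⟩ := (hlim (‖c‖ + L + ρ + 2) ε₁ hε₁).exists
  set p : Fin (φ j) → E3 := fun i => x (φ j) i + τ j with hp
  have hpg : IsGroundState lennardJones p :=
    (isGroundState_add_const_iff lennardJones (τ j)).2 (hx (φ j))
  have hpsep : ∀ k l : Fin (φ j), k ≠ l → r ≤ dist (p k) (p l) := hsepgs _ p hpg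
  have hA' : ∀ s ∈ X, ‖s‖ ≤ ‖c‖ + L + ρ + 2 → ∃ i : Fin (φ j), dist (p i) s ≤ ε₁ := hAj
  have hB' : ∀ i : Fin (φ j), ‖p i‖ ≤ ‖c‖ + L + ρ + 2 → ∃ s ∈ X, dist (p i) s ≤ ε₁ := hBj
  /- (5) the matching map on the window -/
  have hnormW : ∀ w ∈ Wf, ‖w‖ ≤ ‖c‖ + L + ρ + 2 := fun w hw => by
    have h := norm_le_norm_add_const_of_dist_le ((hmemW w).1 hw).2
    linarith
  obtain ⟨i₀, -⟩ := hA' y₀ hy₀X (hnormW y₀ (hYW hy₀))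
  haveI : Nonempty (Fin (φ j)) := ⟨i₀⟩
  choose! idx hidx using fun w (hw : w ∈ Wf) => hA' w ((hmemW w).1 hw).1 (hnormW w hw)
  have huniq : ∀ i : Fin (φ j), ∀ s ∈ Wf, dist (p i) s ≤ ε₁ → i = idx s := by
    intro i s hs his
    by_contra hne
    have h1 := hpsep i (idx s) hne
    have h2 : dist (p i) (p (idx s)) ≤ 2 * ε₁ :=
      calc dist (p i) (p (idx s)) ≤ dist (p i) s + dist (p (idx s)) s := dist_triangle_right _ _ _
        _ ≤ ε₁ + ε₁ := add_le_add his (hidx s hs)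
        _ = 2 * ε₁ := by ring
    linarith
  have hinj : Set.InjOn idx (Wf : Set E3) := by
    intro w hw w' hw' hww'
    by_contra hne
    have h1 := hsepX w ((hmemW w).1 hw).1 w' ((hmemW w').1 hw').1 hne
    have h2 : dist w w' ≤ 2 * ε₁ :=
      calc dist w w' ≤ dist (p (idx w)) w + dist (p (idx w)) w' := dist_triangle_left _ _ _
        _ ≤ ε₁ + ε₁ := add_le_add (hidx w hw) (by rw [hww']; exact hidx w' hw')
        _ = 2 * ε₁ := by ring
    linarith
  /- (6) the particles of the ball and the cut-and-paste bound -/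
  set Sb : Finset (Fin (φ j)) := Finset.univ.filter fun i => dist (p i) c ≤ L + ε₁ with hSb
  have hSb_iff : ∀ i, i ∈ Sb ↔ dist (p i) c ≤ L + ε₁ := fun i => by simp [hSb]
  have himage : Yf.image idx = Sb :=
    image_eq_ball (fun i hi => hB' i ((norm_le_norm_add_const_of_dist_le hi).trans (by linarith)))
      hgap hε₁g hmemY hYW hidx huniq Sb hSb_iff
  have hcardSb : Sb.card = Yf.card := by
    rw [← himage, Finset.card_image_of_injOn (hinj.mono (Finset.coe_subset.2 hYW))]
  have hcutS := hcut _ p hpg hpsep c (L + ε₁) (by linarith) Sb hSb_iff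
  rw [hcardSb] at hcutS
  /- (7) site sums against site energies, summed over the ball -/
  have hsite : ∀ y ∈ Yf,
      ∑' z : ↥({z : E3 | z ∈ X ∧ z ≠ y} : Set E3), lennardJones (dist y (z : E3)) ≤
        siteEnergy lennardJones p (idx y) + (M * ω + T) := fun y hy =>
    tsum_site_le_siteEnergy_add hpg.1 hr hsepX hpsep hB' hmod hρ2 hρr hε₁ε₀ hε₁4 hωpos.le
      hmemW hidx hinj huniq ((hmemY y).1 hy).1 ((hmemY y).1 hy).2
  have hsum : ∑ y ∈ Yf, ∑' z : ↥({z : E3 | z ∈ X ∧ z ≠ y} : Set E3),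
      lennardJones (dist y (z : E3)) ≤
      ∑ i ∈ Sb, siteEnergy lennardJones p i + Yf.card * (M * ω + T) :=
    calc ∑ y ∈ Yf, ∑' z : ↥({z : E3 | z ∈ X ∧ z ≠ y} : Set E3), lennardJones (dist y (z : E3))
        ≤ ∑ y ∈ Yf, (siteEnergy lennardJones p (idx y) + (M * ω + T)) := Finset.sum_le_sum hsite
      _ = ∑ y ∈ Yf, siteEnergy lennardJones p (idx y) + Yf.card * (M * ω + T) := by
          rw [Finset.sum_add_distrib, Finset.sum_const, nsmul_eq_mul]
      _ = ∑ i ∈ Sb, siteEnergy lennardJones p i + Yf.card * (M * ω + T) := by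
          rw [← himage, Finset.sum_image fun a ha b hb h => hinj (hYW ha) (hYW hb) h]
  /- (8) the error budget -/
  have hEn : 2 * groundStateEnergy lennardJones 3 Yf.card ≤ 2 * e * Yf.card + ε / 4 * L ^ 3 := by
    by_cases hcase : 0 < Yf.card ∧ n₀ ≤ Yf.card
    · have hnpos : (0 : ℝ) < Yf.card := by exact_mod_cast hcase.1
      have h1 := hn₀ _ hcase.2
      rw [div_lt_iff₀ hnpos] at h1
      have h2 : ε / (8 * K₀) * Yf.card ≤ ε / 8 * L ^ 3 :=
        calc ε / (8 * K₀) * Yf.card ≤ ε / (8 * K₀) * (K₀ * L ^ 3) :=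
              mul_le_mul_of_nonneg_left hnK hε'.le
          _ = ε / 8 * L ^ 3 := by field_simp
      have h3 : (e + ε / (8 * K₀)) * Yf.card = e * Yf.card + ε / (8 * K₀) * Yf.card := by ring
      linarith only [h1, h2, h3]
    · have hE0 := ChargedEnergyGapNegative.groundStateEnergy_nonpos Yf.card
      have hn_le : (Yf.card : ℝ) ≤ n₀ := by
        rcases not_and_or.1 hcase with h | h
        · have h' : Yf.card = 0 := Nat.le_zero.1 (not_lt.1 h)
          rw [h']
          exact_mod_cast Nat.zero_le n₀
        · exact_mod_cast (not_le.1 h).le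
      have h1 : e * n₀ ≤ e * Yf.card := mul_le_mul_of_nonpos_left hn_le he_neg.le
      have h2 : 8 * (-e) * n₀ / ε ≤ L ^ 3 := hLe.trans hLL3
      rw [div_le_iff₀ hε] at h2
      linarith only [h1, h2, hE0]
  have hsurf : C * (L + ε₁) ^ 2 ≤ ε / 4 * L ^ 3 := by
    have h1 : (L + ε₁) ^ 2 ≤ (2 * L) ^ 2 := pow_le_pow_left₀ (by positivity) (by linarith) 2
    have h3 : 16 * C ≤ L * ε := by rwa [div_le_iff₀ hε] at hLC
    calc C * (L + ε₁) ^ 2 ≤ C * (2 * L) ^ 2 := mul_le_mul_of_nonneg_left h1 hC0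
      _ = (16 * C) * L ^ 2 / 4 := by ring
      _ ≤ (L * ε) * L ^ 2 / 4 := by gcongr
      _ = ε / 4 * L ^ 3 := by ring
  have htail : (Yf.card : ℝ) * T ≤ ε / 4 * L ^ 3 :=
    calc (Yf.card : ℝ) * T ≤ K₀ * L ^ 3 * T := mul_le_mul_of_nonneg_right hnK hT0
      _ = (K₀ * T) * L ^ 3 := by ring
      _ ≤ ε / 4 * L ^ 3 := mul_le_mul_of_nonneg_right hKT (by positivity)
  have hcontE : (Yf.card : ℝ) * (M * ω) ≤ ε / 8 * L ^ 3 :=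
    calc (Yf.card : ℝ) * (M * ω) ≤ K₀ * L ^ 3 * (M * ω) :=
          mul_le_mul_of_nonneg_right hnK (by positivity)
      _ = (K₀ * M * ω) * L ^ 3 := by ring
      _ = ε / 8 * L ^ 3 := by rw [hKMω]
  have hL3 : 0 ≤ ε * L ^ 3 := by positivity
  have hnMT : (Yf.card : ℝ) * (M * ω + T) = Yf.card * (M * ω) + Yf.card * T := by ring
  linarith only [hsum, hcutS, hEn, hsurf, htail, hcontE, hnMT, hL3]

/-- **Item stmt-AtomisticToContinuum-12090 `HullBulkOptimal`** (route `HullExactificationCascade`,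
support (E)): for Lennard-Jones ground states `x` and every `δ`-separated hull element `S`
(two-sided `ε`-matching of translates `x^(φ j) + τ_j` on every ball, eventually in `j`),
`∀ ε > 0 ∃ L₀ ∀ L ≥ L₀ ∀ c, Σ_{y ∈ S ∩ B̄_L(c)} Σ'_{z ∈ S, z ≠ y} V_LJ(|y − z|) ≤
2 e_∞ #(S ∩ B̄_L(c)) + ε L³`, `e_∞ = liminf E(N)/N` — by
`HullBulkOptimal.sum_site_le_of_matched` (the separation hypothesis and `StrictMono φ` are not
needed: the separation of `S` follows from the matching and `LennardJonesMinimalDistance_holds`).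
[folklore] -/
theorem hullBulkOptimal_proof :
    Summit.AtomisticToContinuum.Crystallization.Theses.HullExactificationCascade.HullBulkOptimal := by
  unfold Summit.AtomisticToContinuum.Crystallization.Theses.HullExactificationCascade.HullBulkOptimal
  intro x hx S δ _hδ _hsep hhull ε hε
  obtain ⟨φ, -, τ, hlim⟩ := hhull
  exact HullBulkOptimal.sum_site_le_of_matched x hx hlim hε

end Summit.AtomisticToContinuum.Crystallization.Theorems

end
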